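import Literature.Combinatorics.Extremal.AffineBlockingNumber
import HarnessLib

/-!
# The blocking number of affine space (Jamison 1977 / Brouwer–Schrijver 1978) — proofs

Topic `Literature/Combinatorics/Extremal`. Sibling proof file of `AffineBlockingNumber.lean`: it
DISCHARGES the two named facts stated there,

* `Jamison1977_nonzero_hyperplane_covering` (Jamison 1977, Theorem 1 in the dual form (I), p. 254 =
  the inequality `|B| ≥ k(n−1)` of Brouwer–Schrijver 1978: affine hyperplanes missing the origin
  that cover `V ∖ {0}` number at least `n(q−1)`), as `Jamison1977_nonzero_hyperplane_covering_holds`;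
* `Jamison1977_thm1` (Jamison 1977, Theorem 1 = Brouwer–Schrijver 1978, Theorem: a set meeting every
  affine hyperplane of an `n`-dimensional space over `𝔽_q`, `n ≥ 1`, has at least `n(q−1)+1`
  points), as `Jamison1977_thm1_holds`.

## The printed proof and this formalisation

Brouwer–Schrijver (Mathematisch Centrum report ZN 64/76; J. Combin. Theory Ser. A 24 (1978)
251–253), proof of the Theorem: let `A` meet all hyperplanes, `0 ∈ A`, `B = A ∖ {0}`; "each
hyperplane `w·x = 1` (`w ≠ 0`) contains a point of `B`", so "`F(w) = ∏_{b ∈ B} (w·b − 1)` vanishes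
on `GF(q)^k ∖ {0}` and `F(0) ≠ 0`", and a polynomial with these two properties has degree
`≥ k(q−1)`; hence `|B| ≥ k(q−1)`. We follow exactly this architecture:

1. `card_mul_le_totalDegree` — THE DEGREE LEMMA: a polynomial over `𝔽_q` in finitely many
   variables vanishing at every non-zero point and not at `0` has total degree `≥ #vars · (q−1)`.
   Brouwer–Schrijver prove it by reducing modulo `xᵢ^q − xᵢ` and comparing with the reduced
   indicator `∏ᵢ (1 − xᵢ^{q−1})` of the origin; we take the shorter road available in Mathlib, Alon's
   Combinatorial Nullstellensatz (`MvPolynomial.combinatorial_nullstellensatz_exists_eval_nonzero`,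
   Alon 1999, Thm 1.2) applied, as in Alon's proof of the Alon–Füredi cube theorem (Alon 1999,
   Thm 6.3, with `{0,1}` replaced by `𝔽_q`), to `P − P(0)·(−1)^n ∏ᵢ (xᵢ^{q−1} − 1)`, which vanishes
   on all of `𝔽_qⁿ` and, if `deg P < n(q−1)`, has the top monomial `∏ᵢ xᵢ^{q−1}` with non-zero
   coefficient (`coeff_prod_X_pow_sub_one`) — a contradiction.
2. `Jamison1977_nonzero_hyperplane_covering_holds` — coordinates (`Module.finBasis`) turn the
   covering functionals into linear forms `Lᵢ = ∑ⱼ fᵢ(bⱼ) xⱼ`; the product `∏ᵢ (Lᵢ − cᵢ)` has total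
   degree `≤ #ι`, vanishes at non-zero points (covering) and not at `0` (`cᵢ ≠ 0`); apply 1.
3. `Jamison1977_thm1_holds` — Jamison's step (I) / the first lines of Brouwer–Schrijver's proof:
   translate a point `s₀ ∈ S` to the origin and dualise, `b ↦ {w | w(b − s₀) = 1}`: these
   hyperplanes of the dual space miss `0` and cover `V* ∖ {0}`, so by 2 (for `V*`,
   `dim V* = dim V`) `|S| − 1 ≥ n(q−1)`.

No new definitions and no new named facts are introduced.

## References

* R. E. Jamison, *Covering finite fields with cosets of subspaces*, J. Combin. Theory Ser. A 22
  (1977) 253–266, Theorem 1 and §(I) p. 254. [Jamison1977]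
* A. E. Brouwer, A. Schrijver, *The blocking number of an affine space*, J. Combin. Theory Ser. A
  24 (1978) 251–253, Theorem and its proof. [BrouwerSchrijver1978]
* N. Alon, *Combinatorial Nullstellensatz*, Combin. Probab. Comput. 8 (1999) 7–29, Thm 1.2 and
  Thm 6.3. [Alon1999]
-/

noncomputable section

namespace Literature.Combinatorics.Extremal

open scoped BigOperators
open MvPolynomial

namespace AffineBlockingNumber

/-! ### The degree lemma -/

section DegreeLemma

variable {F : Type*} [Field F] {σ : Type*}

/-- The coefficient of `∏_{j ∈ s} x_j^k` in `∏_{j ∈ s} (x_j^k − 1)` is `1` (`k ≥ 1`).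
[cite: Alon1999, Thm 6.3 (proof: "the coefficient of `∏ xᵢ` … is … `≠ 0`")] -/
theorem coeff_prod_X_pow_sub_one [DecidableEq σ] {k : ℕ} (hk : 1 ≤ k) (s : Finset σ) :
    coeff (∑ j ∈ s, Finsupp.single j k) (∏ j ∈ s, ((X j : MvPolynomial σ F) ^ k - 1)) = 1 := by
  induction s using Finset.induction_on with
  | empty => rw [Finset.sum_empty, Finset.prod_empty, coeff_zero_one]
  | @insert a s ha ih =>
    rw [Finset.sum_insert ha, Finset.prod_insert ha, sub_mul, one_mul, coeff_sub,
      X_pow_eq_monomial, coeff_monomial_mul, one_mul, ih, coeff_eq_zero_of_totalDegree_lt, sub_zero]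
    -- the degree of `x_a^k ∏_{s} x_j^k` exceeds the total degree of `∏_{s} (x_j^k − 1)`
    rw [← Finsupp.degree_apply, map_add, map_sum, Finsupp.degree_single]
    simp only [Finsupp.degree_single, Finset.sum_const, smul_eq_mul]
    refine lt_of_le_of_lt (totalDegree_finsetProd _ _) ?_
    refine lt_of_le_of_lt (Finset.sum_le_card_nsmul s _ k fun j _ => ?_) ?_
    · refine (totalDegree_sub _ _).trans ?_
      rw [totalDegree_one, max_eq_left (Nat.zero_le _)]
      exact (totalDegree_X_pow _ _).le
    · rw [smul_eq_mul]
      omega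

/-- **The degree lemma** (Brouwer–Schrijver 1978, the heart of the proof; here via Alon's
Combinatorial Nullstellensatz): over a finite field with `q` elements, a polynomial in the
variables `σ` that vanishes at every non-zero point of `𝔽_q^σ` but not at the origin has total
degree at least `|σ|·(q−1)`. [cite: BrouwerSchrijver1978, Theorem (proof)]
[cite: Alon1999, Thm 1.2 and Thm 6.3 (proof)] -/
theorem card_mul_le_totalDegree [Fintype F] [Fintype σ] [DecidableEq σ] (P : MvPolynomial σ F)
    (h0 : eval 0 P ≠ 0) (hx : ∀ x : σ → F, x ≠ 0 → eval x P = 0) :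
    Fintype.card σ * (Fintype.card F - 1) ≤ P.totalDegree := by
  by_contra hlt
  rw [not_le] at hlt
  set q := Fintype.card F with hq
  set n := Fintype.card σ with hn
  have hq1 : 1 ≤ q - 1 := by
    have : 1 < q := Fintype.one_lt_card
    omega
  -- the (signed) indicator of the origin, `D = ∏ⱼ (xⱼ^{q−1} − 1)`, and the corrected polynomial `Q`
  set D : MvPolynomial σ F := ∏ j : σ, ((X j : MvPolynomial σ F) ^ (q - 1) - 1) with hD
  set c : F := eval 0 P * (-1) ^ n with hc
  set Q : MvPolynomial σ F := P - C c * D with hQ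
  set t : σ →₀ ℕ := ∑ j : σ, Finsupp.single j (q - 1) with ht
  have hD0 : eval (0 : σ → F) D = (-1) ^ n := by
    rw [hD, eval_prod]
    simp only [map_sub, map_pow, eval_X, Pi.zero_apply, map_one, zero_pow (by omega : q - 1 ≠ 0),
      zero_sub, Finset.prod_const, Finset.card_univ, hn]
  have hDx : ∀ x : σ → F, x ≠ 0 → eval x D = 0 := by
    intro x hx0
    obtain ⟨j, hj⟩ : ∃ j, x j ≠ 0 := by
      by_contra hall
      exact hx0 (funext fun j => not_not.1 fun h => hall ⟨j, h⟩)
    rw [hD, eval_prod]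
    apply Finset.prod_eq_zero (Finset.mem_univ j)
    rw [map_sub, map_pow, eval_X, map_one, FiniteField.pow_card_sub_one_eq_one (x j) hj, sub_self]
  -- `Q` vanishes identically on `𝔽_q^σ`
  have hQ0 : ∀ x : σ → F, eval x Q = 0 := by
    intro x
    by_cases hx0 : x = 0
    · subst hx0
      rw [hQ, map_sub, map_mul, eval_C, hD0, hc, mul_assoc, ← pow_add, ← two_mul, pow_mul]
      norm_num
    · rw [hQ, map_sub, map_mul, hDx x hx0, mul_zero, sub_zero, hx x hx0]
  -- the top coefficient of `Q` at `t = ∏ⱼ xⱼ^{q−1}` is `−c ≠ 0`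
  have hdegt : Finsupp.degree t = n * (q - 1) := by
    rw [ht, map_sum]
    simp only [Finsupp.degree_single, Finset.sum_const, Finset.card_univ, smul_eq_mul, hn]
  have hcoeffP : coeff t P = 0 := by
    apply coeff_eq_zero_of_totalDegree_lt
    rw [← Finsupp.degree_apply, hdegt]
    exact hlt
  have hcoeffQ : coeff t Q = -c := by
    rw [hQ, coeff_sub, hcoeffP, coeff_C_mul, hD, ht, coeff_prod_X_pow_sub_one hq1, mul_one,
      zero_sub]
  have hc0 : c ≠ 0 := mul_ne_zero h0 (pow_ne_zero _ (neg_ne_zero.2 one_ne_zero))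
  -- the total degree of `Q` is exactly `n(q−1)`
  have hDdeg : D.totalDegree ≤ n * (q - 1) := by
    refine (totalDegree_finsetProd _ _).trans ?_
    refine (Finset.sum_le_card_nsmul _ _ (q - 1) fun j _ => ?_).trans ?_
    · refine (totalDegree_sub _ _).trans ?_
      rw [totalDegree_one, max_eq_left (Nat.zero_le _)]
      exact (totalDegree_X_pow _ _).le
    · rw [Finset.card_univ, smul_eq_mul]
  have hQdeg : Q.totalDegree = Finsupp.degree t := by
    apply le_antisymm
    · rw [hdegt, hQ]
      refine (totalDegree_sub _ _).trans (max_le hlt.le ?_)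
      refine (totalDegree_mul _ _).trans ?_
      rw [totalDegree_C, zero_add]
      exact hDdeg
    · rw [Finsupp.degree_apply]
      apply le_totalDegree
      rw [mem_support_iff, hcoeffQ]
      exact neg_ne_zero.2 hc0
  -- Alon's Combinatorial Nullstellensatz on the grid `𝔽_q^σ`: a contradiction
  have htj : ∀ j : σ, t j < (Finset.univ : Finset F).card := by
    intro j
    rw [Finset.card_univ, ht, Finsupp.finsetSum_apply]
    simp only [Finsupp.single_apply, Finset.sum_ite_eq', Finset.mem_univ, if_true]
    omega
  obtain ⟨x, -, hx'⟩ := combinatorial_nullstellensatz_exists_eval_nonzero Q t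
    (by rw [hcoeffQ]; exact neg_ne_zero.2 hc0) hQdeg (fun _ => Finset.univ) htj
  exact hx' (hQ0 x)

end DegreeLemma

end AffineBlockingNumber

/-! ### The discharges -/

/-- **DISCHARGE of `Jamison1977_nonzero_hyperplane_covering`** (Jamison 1977, Theorem 1 in the dual
form (I); Brouwer–Schrijver 1978, the inequality `|B| ≥ k(n−1)`): finitely many affine hyperplanes
`{x | fᵢ x = cᵢ}`, `cᵢ ≠ 0`, covering `V ∖ {0}` number at least `dim V · (q−1)`. Proof: in
coordinates the product `∏ᵢ (fᵢ − cᵢ)` has total degree `≤ #ι`, vanishes off the origin and not at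
it; apply the degree lemma. [cite: Jamison1977, Theorem 1 with §(I) p. 254]
[cite: BrouwerSchrijver1978, Theorem (proof)] -/
theorem Jamison1977_nonzero_hyperplane_covering_holds : Jamison1977_nonzero_hyperplane_covering := by
  intro F _ _ V _ _ _ ι _ f c hc hcov
  classical
  set n := Module.finrank F V with hn
  let b : Module.Basis (Fin n) F V := Module.finBasis F V
  -- the functionals as linear forms in the coordinates
  let L : ι → MvPolynomial (Fin n) F := fun i => ∑ j : Fin n, C (f i (b j)) * X j
  have hL : ∀ (x : Fin n → F) (i : ι), eval x (L i) = f i (b.equivFun.symm x) := by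
    intro x i
    simp only [L, map_sum, map_mul, eval_C, eval_X, Module.Basis.equivFun_symm_apply, map_smul,
      smul_eq_mul]
    exact Finset.sum_congr rfl fun j _ => mul_comm _ _
  set P : MvPolynomial (Fin n) F := ∏ i, (L i - C (c i)) with hP
  have hP0 : eval 0 P ≠ 0 := by
    rw [hP, eval_prod]
    refine Finset.prod_ne_zero_iff.2 fun i _ => ?_
    rw [map_sub, hL, eval_C, map_zero, map_zero, zero_sub]
    exact neg_ne_zero.2 (hc i)
  have hPx : ∀ x : Fin n → F, x ≠ 0 → eval x P = 0 := by
    intro x hx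
    have hv : b.equivFun.symm x ≠ 0 := by
      intro h
      have := congrArg b.equivFun h
      simp only [LinearEquiv.apply_symm_apply, map_zero] at this
      exact hx this
    obtain ⟨i, hi⟩ := hcov _ hv
    rw [hP, eval_prod]
    exact Finset.prod_eq_zero (Finset.mem_univ i) (by rw [map_sub, hL, eval_C, hi, sub_self])
  have hdeg : P.totalDegree ≤ Fintype.card ι := by
    rw [hP]
    refine (totalDegree_finsetProd _ _).trans ?_
    refine (Finset.sum_le_card_nsmul _ _ 1 fun i _ => ?_).trans
      (by rw [Finset.card_univ, smul_eq_mul, mul_one])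
    refine (totalDegree_sub_C_le _ _).trans ?_
    refine totalDegree_finsetSum_le fun j _ => ?_
    refine (totalDegree_mul _ _).trans ?_
    rw [totalDegree_C, zero_add]
    exact (totalDegree_X _).le
  have key := AffineBlockingNumber.card_mul_le_totalDegree P hP0 hPx
  rw [Fintype.card_fin] at key
  exact key.trans hdeg

/-- **DISCHARGE of `Jamison1977_thm1`** (Jamison 1977, Theorem 1 = Brouwer–Schrijver 1978,
Theorem: a set meeting every affine hyperplane of an `n`-dimensional space over `𝔽_q`, `n ≥ 1`,
has at least `n(q−1)+1` points). Proof (Jamison's step (I) / Brouwer–Schrijver): pick `s₀ ∈ S`;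
the hyperplanes `{w | w(s − s₀) = 1}` (`s ∈ S ∖ {s₀}`) of the dual space miss `0` and cover
`V* ∖ {0}`, so `|S| − 1 ≥ dim V* · (q−1) = n(q−1)` by the covering form.
[cite: Jamison1977, Theorem 1 (p. 254)] [cite: BrouwerSchrijver1978, Theorem] -/
theorem Jamison1977_thm1_holds : Jamison1977_thm1 := by
  intro F _ _ V _ _ _ S hn hS
  classical
  -- a non-zero functional exists, so `S` is non-empty
  have hdual : 0 < Module.finrank F (Module.Dual F V) := by rwa [Subspace.dual_finrank_eq]
  obtain ⟨f₀, hf₀⟩ :=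
    (Module.finrank_pos_iff_exists_ne_zero (R := F) (M := Module.Dual F V)).1 hdual
  obtain ⟨s₀, hs₀, -⟩ := hS f₀ 0 hf₀
  -- dualise around `s₀`
  have hcard : Fintype.card {u // u ∈ S.erase s₀} = S.card - 1 := by
    rw [Fintype.card_coe, Finset.card_erase_of_mem hs₀]
  have key := Jamison1977_nonzero_hyperplane_covering_holds F (Module.Dual F V)
    {u // u ∈ S.erase s₀} (fun u => Module.Dual.eval F V ((u : V) - s₀)) (fun _ => 1)
    (fun _ => one_ne_zero) ?_
  · rw [Subspace.dual_finrank_eq, hcard] at key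
    have : 1 ≤ S.card := Finset.card_pos.2 ⟨s₀, hs₀⟩
    omega
  · intro φ hφ
    obtain ⟨s, hs, hφs⟩ := hS φ (1 + φ s₀) hφ
    have hne : s ≠ s₀ := by
      rintro rfl
      have h10 : (1 : F) = 0 := by linear_combination -hφs
      exact one_ne_zero h10
    refine ⟨⟨s, Finset.mem_erase.2 ⟨hne, hs⟩⟩, ?_⟩
    show (Module.Dual.eval F V (s - s₀)) φ = 1
    rw [Module.Dual.eval_apply, map_sub, hφs, add_sub_cancel_right]

end Literature.Combinatorics.Extremal
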